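import Mathlib
import HarnessLib
import Summits.ValiantsHypothesis.ValiantsHypothesis.Theorems.MonotoneRestorationOrbitRestorationQPSmlDeltaCalculus
import Summits.ValiantsHypothesis.ValiantsHypothesis.Theorems.MonotoneRestorationOrbitRestorationQPSmlChainRule
import Summits.ValiantsHypothesis.ValiantsHypothesis.Theorems.MonotoneRestorationOrbitRestorationQPSmlFlattening

/-!
# `x_{ab} ↦ y_a` is injective on column-symmetric column-set-multilinear expressions
(crux `OrbitRestorationQP`, stmt-ValiantsHypothesis-18293 — lane SML: the column-set-multilinear `ΣΠΣ` stratum of A_∞)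

F6a of the blueprint `SML-STRATUM-BLUEPRINT.md`: the dictionary `f ↦ p = rename Prod.fst f` loses nothing on
column-symmetric column-set-multilinear `ΣΠΣ` expressions `f = Σ_t Π_{b<n} (Σ_a α_{t,b,a} x_{(a,b)})`:

* `colSml_eq_sum_monomials` — `f = Σ_{ρ : Fin n → Fin n} C (Σ_t Π_b α_{t,b,ρ b}) · Π_b x_{(ρ b, b)}`;
* `coeff_of_rename_fst` — for column-symmetric `f` and every `ρ`, the top-order derivative `∂_ρ p` (all `n` variables)
  equals `N_n · (Σ_t Π_b α_{t,b,ρ b})` with `N_n = #{injective κ : Fin n → Fin n} ≥ 1`;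
* `colSml_eq_zero_of_rename_fst_eq_zero` — hence `rename fst f = 0 → f = 0`, and two column-symmetric column-sml
  expressions with the same image are equal (`colSml_eq_of_rename_fst_eq`).
This is what turns a narrow power-sum expansion of `p` into an explicit equivariant `ΣΠΣ` formula for `f`. [folklore]
-/

set_option linter.dupNamespace false

namespace Summit.ValiantsHypothesis.ValiantsHypothesis.Theorems.SmlInjective

open MvPolynomial SmlDeltaCalculus SmlChainRule SmlFlattening

/-- Monomial expansion of a column-set-multilinear expression. [folklore] -/
theorem colSml_eq_sum_monomials {ι : Type*} [Fintype ι] {n : ℕ} (α : ι → Fin n → Fin n → ℂ) :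
    (∑ t : ι, ∏ b : Fin n, ∑ a : Fin n, C (α t b a) * X (a, b) : MvPolynomial (Fin n × Fin n) ℂ) =
      ∑ ρ : Fin n → Fin n, C (∑ t : ι, ∏ b : Fin n, α t b (ρ b)) * ∏ b : Fin n, X (ρ b, b) := by
  classical
  have hterm : ∀ t : ι, (∏ b : Fin n, ∑ a : Fin n, C (α t b a) * X (a, b) : MvPolynomial (Fin n × Fin n) ℂ) =
      ∑ ρ : Fin n → Fin n, C (∏ b : Fin n, α t b (ρ b)) * ∏ b : Fin n, X (ρ b, b) := by
    intro t
    rw [Fintype.prod_sum (fun b a => C (α t b a) * X (a, b))]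
    refine Finset.sum_congr rfl fun ρ _ => ?_
    rw [Finset.prod_mul_distrib, map_prod]
  simp_rw [hterm]
  rw [Finset.sum_comm]
  refine Finset.sum_congr rfl fun ρ _ => ?_
  rw [map_sum, Finset.sum_mul]

/-- **Top-order derivatives read off the monomial coefficients.**  For a column-symmetric column-sml expression `f` and
`p = rename fst f`: `∂_{ρ(0)} ⋯ ∂_{ρ(n-1)} p = N · C (Σ_t Π_b α_{t,b,ρ b})`, where `N ≥ 1` is the number of injective
column tuples. [folklore] -/
theorem pderivFold_rename_fst_top {ι : Type*} [Fintype ι] {n : ℕ} (α : ι → Fin n → Fin n → ℂ)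
    (hcol : ∀ τ : Equiv.Perm (Fin n), rename (fun v : Fin n × Fin n => (v.1, τ v.2))
      (∑ t : ι, ∏ b : Fin n, ∑ a : Fin n, C (α t b a) * X (a, b) : MvPolynomial (Fin n × Fin n) ℂ) =
      ∑ t : ι, ∏ b : Fin n, ∑ a : Fin n, C (α t b a) * X (a, b))
    (ρ : Fin n → Fin n) :
    List.foldl (fun (q : MvPolynomial (Fin n) ℂ) i => pderiv (ρ i) q)
        (rename (Prod.fst : Fin n × Fin n → Fin n)
          (∑ t : ι, ∏ b : Fin n, ∑ a : Fin n, C (α t b a) * X (a, b))) (List.finRange n) =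
      ((Finset.univ.filter fun κ : Fin n → Fin n => Function.Injective κ).card : MvPolynomial (Fin n) ℂ) *
        C (∑ t : ι, ∏ b : Fin n, α t b (ρ b)) := by
  classical
  rw [pderivFold_rename_fst]
  -- each injective `κ` contributes the same constant, the others contribute `0`
  have hval : ∀ κ : Fin n → Fin n, rename (Prod.fst : Fin n × Fin n → Fin n)
      (List.foldl (fun (q : MvPolynomial (Fin n × Fin n) ℂ) i => pderiv (ρ i, κ i) q)
        (∑ t : ι, ∏ b : Fin n, ∑ a : Fin n, C (α t b a) * X (a, b)) (List.finRange n)) =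
      if Function.Injective κ then C (∑ t : ι, ∏ b : Fin n, α t b (ρ b)) else 0 := by
    intro κ
    by_cases hκ : Function.Injective κ
    · rw [if_pos hκ, rename_fst_pderivFold_of_colSymm _ hcol ρ id κ Function.injective_id hκ,
        pderivFoldList_sum, map_sum, map_sum]
      refine Finset.sum_congr rfl fun t _ => ?_
      have h := pderivFold_prod_linearForms (α t) n ρ id Finset.univ 1
      rw [map_one, one_mul] at h
      rw [h, if_pos ⟨Function.injective_id, fun i => Finset.mem_univ _⟩, one_mul]
      have hempty : (Finset.univ : Finset (Fin n)) \ Finset.univ.image (id : Fin n → Fin n) = ∅ := by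
        rw [Finset.image_id, Finset.sdiff_self]
      rw [hempty, Finset.prod_empty, mul_one, rename_C]
      rfl
    · rw [if_neg hκ, pderivFoldList_sum, map_sum]
      refine Finset.sum_eq_zero fun t _ => ?_
      have h := pderivFold_prod_linearForms (α t) n ρ κ Finset.univ 1
      rw [map_one, one_mul] at h
      rw [h, if_neg (fun h' => hκ h'.1), map_zero]
  simp_rw [hval]
  rw [Finset.sum_ite, Finset.sum_const_zero, add_zero, Finset.sum_const, nsmul_eq_mul]

/-- **Injectivity.**  A column-symmetric column-sml expression with `rename fst f = 0` is `0`. [folklore] -/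
theorem colSml_eq_zero_of_rename_fst_eq_zero {ι : Type*} [Fintype ι] {n : ℕ} (α : ι → Fin n → Fin n → ℂ)
    (hcol : ∀ τ : Equiv.Perm (Fin n), rename (fun v : Fin n × Fin n => (v.1, τ v.2))
      (∑ t : ι, ∏ b : Fin n, ∑ a : Fin n, C (α t b a) * X (a, b) : MvPolynomial (Fin n × Fin n) ℂ) =
      ∑ t : ι, ∏ b : Fin n, ∑ a : Fin n, C (α t b a) * X (a, b))
    (h0 : rename (Prod.fst : Fin n × Fin n → Fin n)
      (∑ t : ι, ∏ b : Fin n, ∑ a : Fin n, C (α t b a) * X (a, b)) = 0) :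
    (∑ t : ι, ∏ b : Fin n, ∑ a : Fin n, C (α t b a) * X (a, b) : MvPolynomial (Fin n × Fin n) ℂ) = 0 := by
  classical
  have hcoef : ∀ ρ : Fin n → Fin n, (∑ t : ι, ∏ b : Fin n, α t b (ρ b)) = 0 := by
    intro ρ
    have h := pderivFold_rename_fst_top α hcol ρ
    rw [h0, SmlChainRule.pderivFoldList_zero] at h
    have hN : ((Finset.univ.filter fun κ : Fin n → Fin n => Function.Injective κ).card : MvPolynomial (Fin n) ℂ) ≠ 0 := by
      rw [Nat.cast_ne_zero]
      exact Finset.card_ne_zero.2 ⟨id, Finset.mem_filter.2 ⟨Finset.mem_univ _, Function.injective_id⟩⟩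
    have h' := (mul_eq_zero.1 h.symm).resolve_left hN
    exact (C_eq_zero.1 h')
  rw [colSml_eq_sum_monomials]
  exact Finset.sum_eq_zero fun ρ _ => by rw [hcoef ρ, map_zero, zero_mul]

/-- **Uniqueness.**  Two column-symmetric column-sml expressions (on index types `ι`, `ι'`) with the same `rename fst`-image
are equal. [folklore] -/
theorem colSml_eq_of_rename_fst_eq {ι ι' : Type*} [Fintype ι] [Fintype ι'] {n : ℕ}
    (α : ι → Fin n → Fin n → ℂ) (β : ι' → Fin n → Fin n → ℂ)
    (hcolα : ∀ τ : Equiv.Perm (Fin n), rename (fun v : Fin n × Fin n => (v.1, τ v.2))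
      (∑ t : ι, ∏ b : Fin n, ∑ a : Fin n, C (α t b a) * X (a, b) : MvPolynomial (Fin n × Fin n) ℂ) =
      ∑ t : ι, ∏ b : Fin n, ∑ a : Fin n, C (α t b a) * X (a, b))
    (hcolβ : ∀ τ : Equiv.Perm (Fin n), rename (fun v : Fin n × Fin n => (v.1, τ v.2))
      (∑ t : ι', ∏ b : Fin n, ∑ a : Fin n, C (β t b a) * X (a, b) : MvPolynomial (Fin n × Fin n) ℂ) =
      ∑ t : ι', ∏ b : Fin n, ∑ a : Fin n, C (β t b a) * X (a, b))
    (heq : rename (Prod.fst : Fin n × Fin n → Fin n)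
        (∑ t : ι, ∏ b : Fin n, ∑ a : Fin n, C (α t b a) * X (a, b)) =
      rename (Prod.fst : Fin n × Fin n → Fin n)
        (∑ t : ι', ∏ b : Fin n, ∑ a : Fin n, C (β t b a) * X (a, b))) :
    (∑ t : ι, ∏ b : Fin n, ∑ a : Fin n, C (α t b a) * X (a, b) : MvPolynomial (Fin n × Fin n) ℂ) =
      ∑ t : ι', ∏ b : Fin n, ∑ a : Fin n, C (β t b a) * X (a, b) := by
  classical
  -- the difference is a column-sml expression on `ι ⊕ ι'` (negate the coefficients of column `0` of the `β` part)
  rcases Nat.eq_zero_or_pos n with rfl | hn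
  · -- no columns: both sides are sums of empty products, determined by their images
    have hα : (∑ t : ι, ∏ b : Fin 0, ∑ a : Fin 0, C (α t b a) * X (a, b) : MvPolynomial (Fin 0 × Fin 0) ℂ) =
        C (Fintype.card ι : ℂ) := by simp
    have hβ : (∑ t : ι', ∏ b : Fin 0, ∑ a : Fin 0, C (β t b a) * X (a, b) : MvPolynomial (Fin 0 × Fin 0) ℂ) =
        C (Fintype.card ι' : ℂ) := by simp
    rw [hα, hβ] at heq ⊢
    rw [rename_C, rename_C] at heq
    rw [C_inj] at heq
    rw [heq]
  · obtain ⟨b₀⟩ : Nonempty (Fin n) := ⟨⟨0, hn⟩⟩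
    let γ : ι ⊕ ι' → Fin n → Fin n → ℂ :=
      Sum.elim α (fun t b a => (if b = b₀ then -1 else 1) * β t b a)
    have hγβ : ∀ t : ι', (∏ b : Fin n, ∑ a : Fin n, C (γ (Sum.inr t) b a) * X (a, b) : MvPolynomial (Fin n × Fin n) ℂ) =
        -∏ b : Fin n, ∑ a : Fin n, C (β t b a) * X (a, b) := by
      intro t
      have hfac : ∀ b : Fin n, (∑ a : Fin n, C (γ (Sum.inr t) b a) * X (a, b) : MvPolynomial (Fin n × Fin n) ℂ) =
          C (if b = b₀ then -1 else 1) * ∑ a : Fin n, C (β t b a) * X (a, b) := by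
        intro b
        simp only [γ, Sum.elim_inr, map_mul, Finset.mul_sum, mul_assoc]
      simp_rw [hfac]
      rw [Finset.prod_mul_distrib, ← map_prod, Finset.prod_ite_eq']
      simp
    have hγ : (∑ t : ι ⊕ ι', ∏ b : Fin n, ∑ a : Fin n, C (γ t b a) * X (a, b) : MvPolynomial (Fin n × Fin n) ℂ) =
        (∑ t : ι, ∏ b : Fin n, ∑ a : Fin n, C (α t b a) * X (a, b)) -
          ∑ t : ι', ∏ b : Fin n, ∑ a : Fin n, C (β t b a) * X (a, b) := by
      rw [Fintype.sum_sum_type]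
      simp only [γ, Sum.elim_inl]
      rw [sub_eq_add_neg, ← Finset.sum_neg_distrib]
      congr 1
      exact Finset.sum_congr rfl fun t _ => hγβ t
    have hcolγ : ∀ τ : Equiv.Perm (Fin n), rename (fun v : Fin n × Fin n => (v.1, τ v.2))
        (∑ t : ι ⊕ ι', ∏ b : Fin n, ∑ a : Fin n, C (γ t b a) * X (a, b) : MvPolynomial (Fin n × Fin n) ℂ) =
        ∑ t : ι ⊕ ι', ∏ b : Fin n, ∑ a : Fin n, C (γ t b a) * X (a, b) := by
      intro τ
      rw [hγ, map_sub, hcolα τ, hcolβ τ]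
    have h0 : rename (Prod.fst : Fin n × Fin n → Fin n)
        (∑ t : ι ⊕ ι', ∏ b : Fin n, ∑ a : Fin n, C (γ t b a) * X (a, b)) = 0 := by
      rw [hγ, map_sub, heq, sub_self]
    have hz := colSml_eq_zero_of_rename_fst_eq_zero γ hcolγ h0
    rw [hγ, sub_eq_zero] at hz
    exact hz

end Summit.ValiantsHypothesis.ValiantsHypothesis.Theorems.SmlInjective
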